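import Summits.NavierStokesRegularity.NavierStokesRegularity.Theorems.ScenarioCensusGeneratorMeter
import HarnessLib

/-!
# GENERATOR METER port, part 2/4: §D the scaling cell with the vertex in the FUTURE of the measured slice (one-slice Tsai law); §E the vertex ON the measured slice (kinematic); §F the translation
# generator (one germ ⇒ periodic ⇒ census A13 BY NAME)

Re-homed for the scenario census (typer seat ns-census-typer-1 g10; the cells A2gnS / A2gn0 / A2gnP / A2gnTf / A2gn2 are MEMBERS OF RECORD «DECIDED IN KERNEL IN FILES» of row A2
(item 84: critic idea-crit-3 g10 PASS 12:19:42Z; ref PRE-CHECK ✓ §19.13; lead label Pineau–Vicol arXiv:2607.09619 Thm 1.9), A2gnE / A2gnT OPEN (typed); this port makes the decided cells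
TREE-decided): VERBATIM PORT of ns-idea-2 LINE g17-3 «generator-meter», `pub/ideators/ns-idea-2/lines/generator-meter/line-generator-meter.lean` sha16 71227eedda12bed6 (934 l.,
lean check rc 0, 0 sorry), split for the 400-line rule into `ScenarioCensusGeneratorMeter` (§A–§C) → `…GeneratorMeterScaling` (§D–§F) → `…GeneratorMeterRank` (§F′–§G) →
`…GeneratorMeterRows` (§I–§J + census KEYS).  Lean text VERBATIM in namespace `…Theorems.ScenarioCensus.GeneratorMeter` (the line's `…Lines.GeneratorMeter` re-homed); port
edits: the line's `local notation "E3"` is spelled as the reducible `abbrev E3` of every census file; `@[conjecture]` on the OPEN rows `Row_A2gnE`, `Row_A2gnT`; one-line docstrings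
added where missing (gate lint).  Statements untouched.

No census VALUE is moved here (row A2 stays OPEN-WITH-LINE; the members become TREE-decided by name); (L′) is NOT proved; no summit statement is proved by this file.
-/

-- the summit and its single problem share the name `NavierStokesRegularity` (D-0017 nested layout)
set_option linter.dupNamespace false

noncomputable section

open Set Function Filter Metric
open scoped Topology
open Literature.Analysis Literature.Analysis.FluidPDE
open Summit.NavierStokesRegularity.NavierStokesRegularity.Theorems

namespace Summit.NavierStokesRegularity.NavierStokesRegularity.Theorems.ScenarioCensus.GeneratorMeter

variable {C : ℝ} {u : ℝ → E3 → E3}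

/-! ## D. The scaling cell with the vertex in the FUTURE of the measured slice (general `(a, σ, τ)`) -/

/-- Normalisation of the scaling reading about the centre: for `σ ≠ 0`,
`𝒢_{0,σ,τ} u (t,y) = σ • (D(u t)(y)[y] + u(t,y) + ((2σt + τ)/σ) ∂ₜu(t,y))`. -/
theorem genReading_centre_normalise {σ : ℝ} (hσ : σ ≠ 0) (τ : ℝ) (u : ℝ → E3 → E3) (t : ℝ) (y : E3) :
    genReading 0 σ τ u t y =
      σ • (fderiv ℝ (u t) y y + u t y + ((2 * σ * t + τ) / σ) • timeDeriv u t y) := by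
  simp only [genReading, zero_add, map_smul, smul_add, smul_smul, mul_div_cancel₀ _ hσ]

/-- The sign invariant: `κ = (2σt₁ + τ)/σ` has the sign of `σ(2σt₁ + τ)`; the vertex time of the
scaling generator `(a, σ, τ)` is `θ = −τ/(2σ) = t₁ − κ/2`, so `κ < 0` iff the vertex lies in the
FUTURE of the slice `t₁`, `κ = 0` iff ON it, `κ > 0` iff in its PAST. -/
theorem kappa_neg_iff (σ τ t₁ : ℝ) :
    (2 * σ * t₁ + τ) / σ < 0 ↔ σ * (2 * σ * t₁ + τ) < 0 := by
  rw [div_neg_iff, mul_neg_iff]; tauto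

/-- Sign of the vertex parameter. -/
theorem kappa_pos_iff (σ τ t₁ : ℝ) :
    0 < (2 * σ * t₁ + τ) / σ ↔ 0 < σ * (2 * σ * t₁ + τ) := by
  rw [div_pos_iff, mul_pos_iff]; tauto

/-- Recentring: the translate `v(s, z) = u(s, z + c)` with `c = −σ⁻¹ a` reads, for the pure scaling
generator `(0, σ, τ)`, what `u` reads for `(a, σ, τ)`. -/
theorem genReading_recentre {σ : ℝ} (hσ : σ ≠ 0) (a : E3) (τ : ℝ) (u : ℝ → E3 → E3) (t : ℝ) (y : E3) :
    genReading 0 σ τ (fun s z => u s (z + (-σ⁻¹) • a)) t y = genReading a σ τ u t (y + (-σ⁻¹) • a) := by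
  rw [genReading_translate]
  congr 1
  rw [zero_sub, smul_smul, mul_neg, mul_inv_cancel₀ hσ, neg_smul, one_smul, neg_neg]

/-- **FUTURE-VERTEX SCALING LAW on ONE GERM of ONE SLICE.** If the reading of a scaling generator
`(a, σ, τ)`, `σ ≠ 0`, whose vertex time `θ = −τ/(2σ)` lies in the FUTURE of the slice
(`σ(2σt₁ + τ) < 0`, i.e. `θ > t₁`; this includes interior vertices `θ ∈ (t₁, 0)`, the apex `θ = 0`
and blow-up points `θ > 0` beyond the slab) vanishes on a nonempty open set of the slice `t₁ < 0`
of `u ∈ A_C`, then `u ≡ 0` on the past.  Germ → slice (`genReading_eq_zero_of_germ`), recentre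
(`genReading_recentre`, the translate is in `A_C`), normalise (`genReading_centre_normalise`), and the
one-slice Tsai law `eq_zero_of_scalingSlice`. No symmetry of `u` is assumed or derived. -/
theorem eq_zero_of_genReading_future (hu : IsTypeIAncientMild C u) {a : E3} {σ τ t₁ : ℝ}
    (ht₁ : t₁ < 0) (hσ : σ ≠ 0) (hfut : σ * (2 * σ * t₁ + τ) < 0) {U : Set E3} (hU : IsOpen U)
    (hne : U.Nonempty) (h : ∀ x ∈ U, genReading a σ τ u t₁ x = 0) : ∀ t < 0, ∀ x, u t x = 0 := by
  have hall : ∀ x, genReading a σ τ u t₁ x = 0 := genReading_eq_zero_of_germ hu ht₁ hU hne h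
  set c : E3 := (-σ⁻¹) • a with hc
  set v : ℝ → E3 → E3 := fun s z => u s (z + c) with hv
  have hvA : IsTypeIAncientMild C v := translationInvariantAfter_isTypeIAncientMild_comp_add_right hu c
  have hκ : (2 * σ * t₁ + τ) / σ < 0 := (kappa_neg_iff σ τ t₁).2 hfut
  have hnorm : ∀ y, fderiv ℝ (v t₁) y y + v t₁ y + ((2 * σ * t₁ + τ) / σ) • timeDeriv v t₁ y = 0 := by
    intro y
    have h0 : genReading 0 σ τ v t₁ y = 0 := by rw [hv, hc, genReading_recentre hσ]; exact hall _
    rw [genReading_centre_normalise hσ] at h0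
    exact (smul_eq_zero.1 h0).resolve_left hσ
  have hv0 := eq_zero_of_scalingSlice hvA ht₁ hκ hnorm
  intro t ht x
  have := hv0 t ht (x - c)
  simpa [hv] using this

/-- **READING — one slice suffices for the tree's slab leaf.** The tree's future-vertex leaf
(`stub_futureVertexLiouvilleIrrotational`, route SymmetryModuliCount/ForcedSymmetry: annihilation by the
scaling generator on the WHOLE slab `t < 0`, vertex `θ > 0`) and the `A = 0` case of its interior-vertex
stub (`stub_interiorVertexVanishing`: annihilation on a backward end containing the vertex) both follow
from annihilation on ONE slice earlier than the vertex: `2σ(t₁ − θ) = 2σt₁ + (−2σθ)`. -/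
theorem eq_zero_of_slabScaling_oneSlice (hu : IsTypeIAncientMild C u) {a : E3} {σ θ t₁ : ℝ}
    (hσ : σ ≠ 0) (ht₁ : t₁ < 0) (hθ : t₁ < θ)
    (h : ∀ x, fderiv ℝ (u t₁) x (a + σ • x) + σ • u t₁ x + (2 * σ * (t₁ - θ)) • timeDeriv u t₁ x = 0) :
    ∀ t < 0, ∀ x, u t x = 0 := by
  have hfut : σ * (2 * σ * t₁ + -(2 * σ * θ)) < 0 := by
    have : σ * (2 * σ * t₁ + -(2 * σ * θ)) = -(2 * σ ^ 2 * (θ - t₁)) := by ring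
    rw [this, neg_lt_zero]
    have hσ2 : 0 < σ ^ 2 := by positivity
    have : 0 < θ - t₁ := by linarith
    positivity
  refine eq_zero_of_genReading_future (a := a) (τ := -(2 * σ * θ)) hu ht₁ hσ hfut isOpen_univ
    univ_nonempty fun x _ => ?_
  rw [genReading_apply]
  convert h x using 3
  ring

/-- **HEADLINE INSTANCE — Leray's own generator.** If ONE GERM of ONE SLICE `t₁ < 0` of `u ∈ A_C` is
annihilated by the backward self-similar (Leray) generator about the apex time `0` with ANY centre
`−σ⁻¹a` and ANY rate `σ ≠ 0` — `D(u t₁)[a + σx] + σ u + 2σt₁ ∂ₜu = 0` near one point — then `u ≡ 0`.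
(`τ = 0`: the vertex `θ = 0` is in the future of every slice.) -/
theorem eq_zero_of_lerayReading (hu : IsTypeIAncientMild C u) {a : E3} {σ t₁ : ℝ} (ht₁ : t₁ < 0)
    (hσ : σ ≠ 0) {U : Set E3} (hU : IsOpen U) (hne : U.Nonempty)
    (h : ∀ x ∈ U, genReading a σ 0 u t₁ x = 0) : ∀ t < 0, ∀ x, u t x = 0 := by
  refine eq_zero_of_genReading_future hu ht₁ hσ ?_ hU hne h
  have hσ2 : 0 < σ ^ 2 := by positivity
  nlinarith

/-- **READING — at slab level the irrotational scaling case needs NO vertex condition.** If `u ∈ A_C`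
is annihilated on a backward end `t < T` (`T ≤ 0`) by a scaling generator `(a, σ, θ)`, `σ ≠ 0`, with
ARBITRARY vertex time `θ ∈ ℝ` (past, interior, apex or future), then `u ≡ 0` on the whole past:
the end contains a slice `t₁ < min θ T`, and one slice earlier than the vertex suffices
(`eq_zero_of_slabScaling_oneSlice`).  The tree's slab statements `stub_futureVertexLiouvilleIrrotational`
(`T = 0`, `θ > 0`) and `stub_interiorVertexVanishing` with `A = 0` (`θ < 0`, `θ ≤ T`) have this shape. -/
theorem eq_zero_of_endScaling_anyVertex (hu : IsTypeIAncientMild C u) {a : E3} {σ θ T : ℝ}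
    (hσ : σ ≠ 0) (hT : T ≤ 0)
    (h : ∀ t < T, ∀ x, fderiv ℝ (u t) x (a + σ • x) + σ • u t x + (2 * σ * (t - θ)) • timeDeriv u t x = 0) :
    ∀ t < 0, ∀ x, u t x = 0 := by
  set t₁ : ℝ := min θ T - 1 with ht₁def
  have h1 : t₁ < θ := by have := min_le_left θ T; linarith
  have h2 : t₁ < T := by have := min_le_right θ T; linarith
  exact eq_zero_of_slabScaling_oneSlice hu hσ (by linarith) h1 (h t₁ h2)

/-- The tree's slab leaf 2a (`stub_futureVertexLiouvilleIrrotational`: `T = 0`, `θ > 0`) has exactly this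
statement; here it is the one-slice law read at the slice `min θ 0 − 1` (the hypothesis `0 < θ` is not used). -/
theorem slabShape2a_of_oneSlice :
    ∀ (C : ℝ) (u : ℝ → E3 → E3), IsTypeIAncientMild C u → ∀ (a : E3) (σ θ : ℝ), σ ≠ 0 → 0 < θ →
      (∀ t < 0, ∀ x, fderiv ℝ (u t) x (a + σ • x) + σ • u t x + (2 * σ * (t - θ)) • timeDeriv u t x = 0) →
      ∀ t < 0, ∀ x, u t x = 0 :=
  fun _ _ hu _ _ _ hσ _ h => eq_zero_of_endScaling_anyVertex hu hσ le_rfl h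

/-- The `A = 0` case of the tree's slab stub 3 (`stub_interiorVertexVanishing`: vertex `θ < 0`, `θ ≤ T ≤ 0`,
annihilation on `t < T` ⇒ `u = 0` on `t < T`) has exactly this statement; the one-slice law gives it with the
stronger conclusion on ALL of `t < 0` and without the hypotheses `θ < 0`, `θ ≤ T`. -/
theorem slabShape3_irrot_of_oneSlice :
    ∀ (C : ℝ) (u : ℝ → E3 → E3), IsTypeIAncientMild C u → ∀ (a : E3) (σ θ T : ℝ), σ ≠ 0 → θ < 0 → θ ≤ T →
      T ≤ 0 → (∀ t < T, ∀ x, fderiv ℝ (u t) x (a + σ • x) + σ • u t x +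
        (2 * σ * (t - θ)) • timeDeriv u t x = 0) → ∀ t < T, ∀ x, u t x = 0 :=
  fun _ _ hu _ _ _ _ hσ _ _ hT h t ht x => eq_zero_of_endScaling_anyVertex hu hσ hT h t (lt_of_lt_of_le ht hT) x

/-! ## E. The vertex ON the measured slice: kinematic -/

/-- **Euler homogeneity of degree `−1` kills a `C¹` slice** (pure calculus, any `C¹` field on `ℝ³`):
if `DU(y)[y] + U(y) = 0` for all `y` then `U ≡ 0` — along the ray through `e`, `r ↦ r U(r e)` has zero
derivative, so `U(e) = 1·U(e) = 0·U(0) = 0`. -/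
theorem eq_zero_of_homogeneousSlice {U : E3 → E3} (hU : Differentiable ℝ U)
    (h : ∀ y, fderiv ℝ U y y + U y = 0) (e : E3) : U e = 0 := by
  set g : ℝ → E3 := fun r => r • U (r • e) with hg
  have hderiv : ∀ r, HasDerivAt g (0 : E3) r := by
    intro r
    have h1 : HasDerivAt (fun r : ℝ => r • e) ((1 : ℝ) • e) r := (hasDerivAt_id r).smul_const e
    have h2 : HasDerivAt (fun r : ℝ => U (r • e)) (fderiv ℝ U (r • e) ((1 : ℝ) • e)) r :=
      (hU (r • e)).hasFDerivAt.comp_hasDerivAt r h1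
    have h3 : HasDerivAt g ((id r : ℝ) • fderiv ℝ U (r • e) ((1 : ℝ) • e) + (1 : ℝ) • U (r • e)) r :=
      (hasDerivAt_id r).smul h2
    have e0 : (id r : ℝ) • fderiv ℝ U (r • e) ((1 : ℝ) • e) + (1 : ℝ) • U (r • e) = 0 := by
      rw [one_smul, one_smul, id, ← map_smul]
      exact h (r • e)
    rwa [e0] at h3
  have hdiff : Differentiable ℝ g := fun r => (hderiv r).differentiableAt
  have hconst := is_const_of_deriv_eq_zero hdiff (fun r => (hderiv r).deriv) 1 0
  simpa [hg] using hconst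

/-- **ON-SLICE VERTEX LAW (kinematic).** If the reading of a scaling generator `(a, σ, τ)`, `σ ≠ 0`,
whose vertex time lies ON the slice (`2σt₁ + τ = 0`) vanishes on a nonempty open set of the slice
`t₁ < 0` of `u ∈ A_C`, then `u ≡ 0`: the recentred slice is Euler-homogeneous of degree `−1` and `C¹`,
hence zero (`eq_zero_of_homogeneousSlice`), and a zero slice kills (`sliceConstLiouville`). Navier–Stokes
enters only through analyticity (germ → slice) and the one-slice Liouville; the tree's slab version
is `stub_interiorVertexVanishing` with `θ = T`. -/
theorem eq_zero_of_genReading_onSlice (hu : IsTypeIAncientMild C u) {a : E3} {σ τ t₁ : ℝ}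
    (ht₁ : t₁ < 0) (hσ : σ ≠ 0) (hon : 2 * σ * t₁ + τ = 0) {U : Set E3} (hU : IsOpen U)
    (hne : U.Nonempty) (h : ∀ x ∈ U, genReading a σ τ u t₁ x = 0) : ∀ t < 0, ∀ x, u t x = 0 := by
  have hall : ∀ x, genReading a σ τ u t₁ x = 0 := genReading_eq_zero_of_germ hu ht₁ hU hne h
  set c : E3 := (-σ⁻¹) • a with hc
  set v : ℝ → E3 → E3 := fun s z => u s (z + c) with hv
  have hvA : IsTypeIAncientMild C v := translationInvariantAfter_isTypeIAncientMild_comp_add_right hu c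
  have hhom : ∀ y, fderiv ℝ (v t₁) y y + v t₁ y = 0 := by
    intro y
    have h0 : genReading 0 σ τ v t₁ y = 0 := by rw [hv, hc, genReading_recentre hσ]; exact hall _
    rw [genReading_centre_normalise hσ, hon, zero_div, zero_smul, add_zero] at h0
    exact (smul_eq_zero.1 h0).resolve_left hσ
  have hV : Differentiable ℝ (v t₁) := (hvA.contDiff_slice ht₁).differentiable (by simp)
  have hslice : ∀ y, v t₁ y = (0 : E3) := eq_zero_of_homogeneousSlice hV hhom
  have hv0 := sliceConstLiouville hvA ht₁ hslice
  intro t ht x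
  have := hv0 t ht (x - c)
  simpa [hv] using this

/-! ## F. The translation generator: one germ ⇒ periodic ⇒ census A13 BY NAME -/

/-- For `σ = 0 = τ` the reading is the directional derivative `D(u t)(x)[a]`. -/
theorem genReading_translation (a : E3) (u : ℝ → E3 → E3) (t : ℝ) (x : E3) :
    genReading a 0 0 u t x = fderiv ℝ (u t) x a := by
  simp [genReading]

/-- A `C¹` slice with vanishing directional derivative along `a` is `a`-periodic (line integration). -/
theorem periodic_of_fderiv_eq_zero {U : E3 → E3} (hU : Differentiable ℝ U) {a : E3}
    (h : ∀ y, fderiv ℝ U y a = 0) (y : E3) : U (y + a) = U y := by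
  set g : ℝ → E3 := fun s => U (y + s • a) with hg
  have hderiv : ∀ s, HasDerivAt g (0 : E3) s := by
    intro s
    have h1 : HasDerivAt (fun s : ℝ => y + s • a) ((1 : ℝ) • a) s :=
      ((hasDerivAt_id s).smul_const a).const_add y
    have h2 := (hU (y + s • a)).hasFDerivAt.comp_hasDerivAt s h1
    rw [one_smul, h (y + s • a)] at h2
    exact h2
  have hdiff : Differentiable ℝ g := fun s => (hderiv s).differentiableAt
  have hconst := is_const_of_deriv_eq_zero hdiff (fun s => (hderiv s).deriv) 1 0
  simpa [hg] using hconst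

/-- **TRANSLATION-GENERATOR LAW.** If `D(u t₁)[a] = 0` on a nonempty open set of one slice of
`u ∈ A_C`, `a ≠ 0`, then `u ≡ 0`: the whole slice is `a`-periodic (`periodic_of_fderiv_eq_zero` after
germ → slice), a germ periodicity is exact at all times (tree `translationInvariant_of_germ`), and a
periodic Type-I ancient mild field vanishes — census A13 BY NAME
(`ScenarioCensus.PeriodicGauge.periodic_typeI_liouville_genuine`). -/
theorem eq_zero_of_genReading_translation (hu : IsTypeIAncientMild C u) {a : E3} (ha : a ≠ 0)
    {t₁ : ℝ} (ht₁ : t₁ < 0) {U : Set E3} (hU : IsOpen U) (hne : U.Nonempty)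
    (h : ∀ x ∈ U, genReading a 0 0 u t₁ x = 0) : ∀ t < 0, ∀ x, u t x = 0 := by
  have hall : ∀ x, fderiv ℝ (u t₁) x a = 0 := fun x => by
    rw [← genReading_translation]; exact genReading_eq_zero_of_germ hu ht₁ hU hne h x
  have hV : Differentiable ℝ (u t₁) := (hu.contDiff_slice ht₁).differentiable (by simp)
  have hper₁ : ∀ y, u t₁ (y + a) = u t₁ y := periodic_of_fderiv_eq_zero hV hall
  have hper : ∀ t < 0, ∀ x, u t (x + a) = u t x := fun t ht x =>
    translationInvariant_of_germ hu ht₁ isOpen_univ univ_nonempty a (fun y _ => hper₁ y) ht x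
  exact ScenarioCensus.PeriodicGauge.periodic_typeI_liouville_genuine C u hu a ha hper

end Summit.NavierStokesRegularity.NavierStokesRegularity.Theorems.ScenarioCensus.GeneratorMeter

end
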